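import Summits.BirchSwinnertonDyer.BirchSwinnertonDyer.Theorems.EdixhovenFibreFiveSevenStarredOptimalManinUnitFiveSevenLocalFormulaSupersingularCellsNumerology
import Summits.BirchSwinnertonDyer.BirchSwinnertonDyer.Theorems.EdixhovenFibreFiveSevenStarredOptimalManinUnitFiveSevenTransportedReciprocityTransportAllPointsOfFormalPoints
import Summits.BirchSwinnertonDyer.BirchSwinnertonDyer.Theorems.EdixhovenFibreFiveSevenStarredOptimalManinUnitFiveSevenOrdinaryCellsModels
import HarnessLib

/-!
# Kato's explicit reciprocity FORMULA over the cells' fields of good reduction, (G)-ORDINARY K★ cells — EVERYTHING BUT THE CAPSTONE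
# (the stub `stub_localFormulaOrdinaryCells` of skeleton v11 REDUCED to the ordinary capstone at the points over deep FORMAL points, transport form)
# (route `EdixhovenFibreFiveSeven`, crux K★ stmt-BirchSwinnertonDyer-22226, line `kato-lever`; seat `bsd-line-edix-p4` g29, width)

HONEST FRAMING. Theorems only (no definition, no named fact, no instance, no `sorry`); helper (`--supports 22226`); nothing is closed: the crux K★ stays OPEN
⟸ {P1-bar, `stub_localFormulaOrdinaryCells`}; BSD is not proved by any of this. This file is the ORDINARY twin of `…LocalFormulaSupersingularCellsNumerology`
(LEAD g30) with the ONE ingredient that does not yet exist — Kato's formula at the points of `W′(F)` over deep FORMAL points of the good ordinary model, for the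
transport isomorphisms `φ : (W′ ⊗ F)(F̄) ≃ E(F̄)` (the ordinary twin of `…TransportedReciprocityTransport` = LEAD bricks B3 + E3 of memo
`Cruxes/…/Lines/kato-lever-seam-rec-at-cells.md` §17, unit-root frame) — taken as a HYPOTHESIS `hcap` («THE ORDINARY CAPSTONE SOCKET»). `hcap` hands the capstone
prover EVERY per-cell datum the tree now has (`…OrdinaryCellsModels.exists_goodModelData_of_ordinary_numerology`: `D`, `D.poly = X^e − p`, `a`, `b`,
`Wm = ⟨0,0,0,aϱ^{r₄},bϱ^{r₆}⟩`, the cells' unit, `ψ₀`, `IsUnit Δ`, `A_p ≠ 0`, `[Xᵖ][p]` unit, `E₀` with `hWE`, `p ∤ Δ(E₀)`, `A_p(E₀) ≠ 0`, `p ∤ a_p`, `‖a_p‖ = 1`, `a_p² < 4p`,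
the three ellipticity instances) and every socket datum (the Weil tower of `W′` with `heL`/`healt`/`henondeg`, the `ℤ_p`-valued `log χ`, the Prop-1.2.3 binders,
the line datum, the transport `φ`, `T_p(φ)`), and asks for E3's output shape with the division sequences formal at EVERY level (`hker : ∀ n`) at SOME depth
`N ≥ 1`. Then: E6 over the formal-point input (`…TransportedReciprocityTransportAllPointsOfFormalPoints` + `exists_transportData_of_variableChange`, as in
`…TransportedReciprocityOfVariableChangeOfFormalPoints`) ∘ `valuation_u_le_one_of_smul_eq_curveFO`
(`|u| ≤ 1` for the package's variable change) ∘ the §6 socket conversions of the supersingular numerology (verbatim).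

* ★★★ `localFormula_of_ordinary_numerology_of_capstone` — generic ordinary numerology;
* ★★★ `localFormulaOrdinaryCells_of_capstone` — **`hcap` ⟹ the statement of `stub_localFormulaOrdinaryCells` VERBATIM** (cell table `9 ↦ 4`, `8 ↦ 3`, `10 ↦ 6`).

So after this file: `stub_localFormulaOrdinaryCells` ⟸ `hcap` (the ordinary capstone in transport form), and K★ ⟸ {P1-bar, `hcap`}
(`…OfOrdinaryLocalFormula.starredOptimalManinUnitFiveSeven_of_ordinaryLocalFormula`, DD ✓ p793225).

References: [Kato1993LNM1553] Ch. II Thm. 1.4.1 (3)–(4), Lemma 1.4.3–1.4.5, §1.2.4; [BlochKato1990] Prop. 3.8, Ex. 3.10.1, Example 3.11; [SilvermanAEC2009]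
III.1, Prop. III.8.1, VII.5.5, IV.4.4, V.4.1, Thm. IV.6.4; [SilvermanATAEC1994] IV Table 4.1; [Serre1972] §1.11.
-/

set_option autoImplicit false
-- single-conjunct summit: `Summit.BirchSwinnertonDyer.BirchSwinnertonDyer.…` repeats the name by design
set_option linter.dupNamespace false

noncomputable section

open Field Function ValuativeRel WittVector NumberField IsDedekindDomain Polynomial
open scoped NumberField Topology Classical NNReal
open Literature.NumberTheory.PAdicHodge Literature.NumberTheory.GaloisRepresentations
  Literature.NumberTheory.GaloisRepresentations.IsNonarchimedeanLocalField Literature.NumberTheory.GaloisRepresentations.LubinTate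
  Literature.NumberTheory.GaloisCohomology Literature.NumberTheory.EllipticCurves Literature.NumberTheory.EllipticCurves.FormalGroupChart
  Literature.NumberTheory.PAdicHodge.GaloisContinuity Literature.IUT.LogVolume Literature.RingTheory.FormalGroups
  Literature.AlgebraicGeometry.Resolution _root_.WeierstrassCurve
  Literature.NumberTheory.EllipticCurves.Rank1Residual Literature.NumberTheory.DiophantineGeometry Rat.HeightOneSpectrum
  Summit.BirchSwinnertonDyer.Rank1Residual Summit.BirchSwinnertonDyer.Rank1Residual.Additive
  Summit.BirchSwinnertonDyer.BirchSwinnertonDyer.Theorems.StarredOptimalManinUnitFiveSevenSupersingularCellsModels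
  Summit.BirchSwinnertonDyer.BirchSwinnertonDyer.Theorems.KimAtThreeDeepLowerExpStarOmega
  Summit.BirchSwinnertonDyer.BirchSwinnertonDyer.Theorems.StarredOptimalManinUnitFiveSevenOrdinaryCellsModels

namespace Summit.BirchSwinnertonDyer.BirchSwinnertonDyer.Theorems.StarredOptimalManinUnitFiveSevenLocalFormulaOrdinaryCellsOfCapstone

variable (W : WeierstrassCurve ℚ) [W.IsElliptic] [W.IsGloballyMinimal] (p : ℕ) [hp : Fact p.Prime]

set_option maxHeartbeats 1600000 in
/-- ★★★ **Kato's explicit reciprocity formula for the DIRECT representation of an ORDINARY-cell curve over `K_{v′}`, generic ordinary numerology, GRANTED the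
ordinary capstone socket `hcap`.** For `W/ℚ` globally minimal, `p ∈ {5, 7}`, `ord_p j(W) ≥ 0`, ordinary numerology `(e, k, m, n, r₄, r₆, t₄, t₆)`, a number field
`K ∋ α`, `α^e = p`, a place `v′ ∋ p` with the packet keys and a compatible `ω′` making `W ⊗ K_{v′}` integral: IF (`hcap`) for every good `𝒪_D`-model datum of the cell
over `F = K_{v′}` with its ordinary reduction data and CM-fibre data, every socket datum of `W` over `F`, and every `Γ_F`-equivariant `φ : (W ⊗ F)(F̄) ≃ E(F̄)` with Tate-module
map, Kato's formula holds at the points of `W(F)` over deep formal points of `E` (E3's output shape, division sequences formal at every level, some depth `N ≥ 1`), THEN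
for every Weil tower of `W` with its seven laws and the Prop-1.2.3 binders: for every line datum `d″` SOME `c′` with `⟨[η″], P′⟩ = Tr_{K_{v′}/ℚ_p}(c′ · exp*_{d″}(η″) · log_{ω′} P′)`.
[cite: Kato1993LNM1553, Ch. II Thm. 1.4.1 (3)–(4), Lemma 1.4.3] [cite: SilvermanAEC2009, III.1, Prop. III.8.1, VII.5.5, IV.4.4 and V.4.1] -/
theorem localFormula_of_ordinary_numerology_of_capstone (hp57 : p = 5 ∨ p = 7) (hj : 0 ≤ padicValRat p W.j)
    {e k m n r₄ r₆ t₄ t₆ : ℕ} (he : 0 < e) (hem : e * m = 4 * k + r₄) (hen : e * n = 6 * k + r₆)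
    (h₄ : 3 * r₄ = e * t₄) (h₆ : 2 * r₆ = e * t₆)
    (hm : 3 * m = padicValInt p W.minimalDiscriminantInt + t₄) (hn : 2 * n = padicValInt p W.minimalDiscriminantInt + t₆)
    (ht₄ : t₄ ≤ 2) (ht₆ : t₆ ≤ 1) (h5 : p = 5 → r₄ = 0 ∧ t₄ = 0 ∧ 0 < t₆) (h7 : p = 7 → r₆ = 0 ∧ t₆ = 0 ∧ 0 < t₄)
    {K : Type} [Field K] [NumberField K] {α : K} (hαe : α ^ e = (p : K))
    (v' : HeightOneSpectrum (𝓞 K)) (hv' : ((p : ℕ) : 𝓞 K) ∈ v'.asIdeal)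
    [CharZero (v'.adicCompletion K)] [Fact (¬ IsUnit ((p : ℕ) : integerC (v'.adicCompletion K)))]
    [IsAdicComplete (Ideal.span {((p : ℕ) : integerC (v'.adicCompletion K))}) (integerC (v'.adicCompletion K))]
    (hp' : valuation (v'.adicCompletion K) ((p : ℕ) : (v'.adicCompletion K)) < 1)
    (ω' : Valuation (v'.adicCompletion K) ℝ≥0) [ω'.Compatible] [(W.baseChange (v'.adicCompletion K)).IsIntegral ω'.integer]
    (eT : (k : ℕ) → geomTorsion W ((p ^ k : ℕ) : ℤ) → geomTorsion W ((p ^ k : ℕ) : ℤ) → AlgebraicClosure ℚ) (hμ : ∀ k S T, eT k S T ^ (p ^ k) = 1)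
    (hadd₁ : ∀ k S₁ S₂ T, eT k (S₁ + S₂) T = eT k S₁ T * eT k S₂ T) (hadd₂ : ∀ k S T₁ T₂, eT k S (T₁ + T₂) = eT k S T₁ * eT k S T₂)
    (hgal : ∀ k (σ : absoluteGaloisGroup ℚ) (S T : geomTorsion W ((p ^ k : ℕ) : ℤ)), σ • eT k S T = eT k (σ • S) (σ • T))
    (hnondeg : ∀ k (T : geomTorsion W ((p ^ k : ℕ) : ℤ)), (∀ S, eT k S T = 1) → T = 0) (halt : ∀ k (S : geomTorsion W ((p ^ k : ℕ) : ℤ)), eT k S S = 1)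
    (hcompat : ∀ k (S T : geomTorsion W ((p ^ (k + 1) : ℕ) : ℤ)),
      eT k (torsionMulHom W (p ^ (k + 1)) (p ^ k) p (pow_succ p k).symm S) (torsionMulHom W (p ^ (k + 1)) (p ^ k) p (pow_succ p k).symm T) = eT (k + 1) S T ^ p)
    (hinjK : letI := LocalField.adicCompletionPadicAlgebra v' p hv'
      (bdRPeriodRingData (F := (v'.adicCompletion K)) (p := p) hp').CupLogInjective (logCyclotomic p) (restrictedRationalTateRep W (v'.adicCompletion K) p))
    (hdeK : letI := LocalField.adicCompletionPadicAlgebra v' p hv'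
      ∀ z : contOneCocycles (restrictedRationalTateRep W (v'.adicCompletion K) p).toTopRep,
        (bdRPeriodRingData (F := (v'.adicCompletion K)) (p := p) hp').HasDualExp (logCyclotomic p) (restrictedRationalTateRep W (v'.adicCompletion K) p) fun σ => z.1 σ)
    (d'' : letI := LocalField.adicCompletionPadicAlgebra v' p hv'
      (bdRPeriodRingData (F := (v'.adicCompletion K)) (p := p) hp').FilZeroLine (restrictedRationalTateRep W (v'.adicCompletion K) p))
    -- THE ORDINARY CAPSTONE SOCKET: Kato's formula at the points of `W(F)` over deep FORMAL points of any good ordinary `𝒪_D`-model of the cell, transport form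
    (hcap : letI := LocalField.padicAlgebra (v'.adicCompletion K) p hp'
      haveI : CharZero (CompletedAlgClosure (v'.adicCompletion K)) :=
        charZero_of_injective_algebraMap (algebraMap (v'.adicCompletion K) (CompletedAlgClosure (v'.adicCompletion K))).injective
      ∀ (D : EisensteinRoot (v'.adicCompletion K) p hp') (_hD : D.poly = X ^ e - C (p : ℤ_[p])) (a b : ℤ)
        (Wm : WeierstrassCurve (EisensteinRoot.CoeffDisc D)) (ψ₀ : EisensteinRoot.CoeffDisc D →+* LTCoeff (v'.adicCompletion K))
        (_hψ₀ : ∀ c, algebraMap (LTCoeff (v'.adicCompletion K)) (v'.adicCompletion K) (ψ₀ c) = EisensteinRoot.CoeffDisc.toF D c)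
        (_hWm : Wm = ⟨0, 0, 0, algebraMap ℤ (EisensteinRoot.CoeffDisc D) a * EisensteinRoot.CoeffDisc.of D (AdjoinRoot.root D.poly) ^ r₄,
          algebraMap ℤ (EisensteinRoot.CoeffDisc D) b * EisensteinRoot.CoeffDisc.of D (AdjoinRoot.root D.poly) ^ r₆⟩)
        (_hu : IsUnit (64 * (a : ℤ_[p]) ^ 3 * (p : ℤ_[p]) ^ t₄ + 432 * (b : ℤ_[p]) ^ 2 * (p : ℤ_[p]) ^ t₆))
        (_hΔ : IsUnit (Wm.map ψ₀).Δ) (_hA : ((Wm.map ψ₀).map (AinfTop.redCoeff (v'.adicCompletion K))).hasseCoeff p ≠ 0)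
        (_h1 : IsUnit (algebraMap (LTCoeff (v'.adicCompletion K)) (CBall (v'.adicCompletion K)) (PowerSeries.coeff p ((Wm.map ψ₀).formalMul p))))
        [(AinfTop.curveFO (v'.adicCompletion K) (Wm.map ψ₀)).IsElliptic]
        [(curveOver (CompletedAlgClosure (v'.adicCompletion K)) (Wm.map ψ₀)).IsElliptic]
        (E₀ : WeierstrassCurve ℤ) (_hE₀ : E₀ = ⟨0, 0, 0, if r₄ = 0 then a else 0, if r₆ = 0 then b else 0⟩)
        (_hWE : Wm.map (Ideal.Quotient.mk (Ideal.span {EisensteinRoot.CoeffDisc.of D (AdjoinRoot.root D.poly)})) =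
          (E₀.map (algebraMap ℤ (EisensteinRoot.CoeffDisc D))).map (Ideal.Quotient.mk (Ideal.span {EisensteinRoot.CoeffDisc.of D (AdjoinRoot.root D.poly)})))
        (_hΔ₀ : ¬ (p : ℤ) ∣ E₀.Δ) (_hA₀ : (E₀.map (Int.castRingHom (ZMod p))).hasseCoeff p ≠ 0)
        (_htr : ¬ (p : ℤ) ∣ HasseManin.tr (E₀.map (Int.castRingHom (ZMod p))))
        (_hnorm : ‖((HasseManin.tr (E₀.map (Int.castRingHom (ZMod p))) : ℤ) : ℤ_[p])‖ = 1)
        (_hsq : HasseManin.tr (E₀.map (Int.castRingHom (ZMod p))) ^ 2 < 4 * p)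
        [(E₀.map (Int.castRingHom ℚ_[p])).IsElliptic] [(E₀.map (Int.castRingHom (ZMod p))).IsElliptic]
        [(curveOver (CompletedAlgClosure (v'.adicCompletion K)) E₀).IsElliptic]
        -- socket data of `W` over `F`
        (ψ : C(absoluteGaloisGroup (v'.adicCompletion K), ℤ_[p])) (_hψ : ∀ σ τ, ψ (σ * τ) = ψ σ + ψ τ)
        (_hψlog : ∀ τ, (ψ τ : ℚ_[p]) = logCyclotomic (F := (v'.adicCompletion K)) p τ)
        (_heL : ∀ (c : ℤ_[p]) (S U : W.tateModule p),
          (weilContPairingPadic W (v'.adicCompletion K) p eT hμ hadd₁ hadd₂ hgal hcompat).toLin (c • S) U =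
          twistHom (v'.adicCompletion K) p ((weilContPairingPadic W (v'.adicCompletion K) p eT hμ hadd₁ hadd₂ hgal hcompat).toLin S U) c)
        (_healt : ∀ S : W.tateModule p, (weilContPairingPadic W (v'.adicCompletion K) p eT hμ hadd₁ hadd₂ hgal hcompat).toLin S S = 0)
        (_henondeg : ∀ S : W.tateModule p,
          (∀ U, (weilContPairingPadic W (v'.adicCompletion K) p eT hμ hadd₁ hadd₂ hgal hcompat).toLin S U = 0) → S = 0)
        (_hinj : (bdRPeriodRingData (F := (v'.adicCompletion K)) (p := p) hp').CupLogInjective (logCyclotomic p)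
          (restrictedRationalTateRep W (v'.adicCompletion K) p))
        (_hde : ∀ η : contOneCocycles (restrictedTateRep W (v'.adicCompletion K) p).toTopRep,
          (bdRPeriodRingData (F := (v'.adicCompletion K)) (p := p) hp').HasDualExp (logCyclotomic p)
            (restrictedRationalTateRep W (v'.adicCompletion K) p) fun σ => TateModule.toRational p (η.1 σ))
        (d : (bdRPeriodRingData (F := (v'.adicCompletion K)) (p := p) hp').FilZeroLine (restrictedRationalTateRep W (v'.adicCompletion K) p))
        -- a depth `N ≥ 1`, then: the transport isomorphism onto the model and its Tate-module map
        , ∃ N : ℕ, N ≠ 0 ∧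
      ∀ (φ : geomPoints (W.baseChange (v'.adicCompletion K)) ≃+ (AinfTop.curveFO (v'.adicCompletion K) (Wm.map ψ₀)).geomPoints)
        (_hφ : ∀ (σ : absoluteGaloisGroup (v'.adicCompletion K)) (P : geomPoints (W.baseChange (v'.adicCompletion K))), φ (σ • P) = σ • φ P)
        (Tφ : (W.baseChange (v'.adicCompletion K)).tateModule p ≃ₗ[ℤ_[p]] (AinfTop.curveFO (v'.adicCompletion K) (Wm.map ψ₀)).tateModule p)
        (_hTφ : ∀ (a : (W.baseChange (v'.adicCompletion K)).tateModule p) (n : ℕ), TateModule.proj p n (Tφ a) = φ (TateModule.proj p n a)),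
      ∃ c : v'.adicCompletion K,
      ∀ (η : contOneCocycles (restrictedTateRep W (v'.adicCompletion K) p).toTopRep)
        (P : (W.baseChange (v'.adicCompletion K)).toAffine.Point)
        (Q : ℕ → geomPoints (W.baseChange (v'.adicCompletion K)))
        (_hQ : ∀ n, p • Q (n + 1) = Q n)
        (_hQ0 : Q 0 = toGeomPoints (W.baseChange (v'.adicCompletion K)) P)
        (hker : ∀ n, AinfTop.geomToCO (Wm.map ψ₀) ((⇑φ ∘ Q) n) ∈ kernel (NormedField.valuation (K := CompletedAlgClosure (v'.adicCompletion K)))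
          (curveOver (CompletedAlgClosure (v'.adicCompletion K)) (Wm.map ψ₀))),
        ‖((zPt (AinfTop.geomToCO (Wm.map ψ₀) ((⇑φ ∘ Q) 0)) (hker 0) : CBall (v'.adicCompletion K)) : CompletedAlgClosure (v'.adicCompletion K))‖ ^ N ≤
            ‖(p : CompletedAlgClosure (v'.adicCompletion K))‖ →
        ∀ cP : v'.adicCompletion K,
          algebraMap (v'.adicCompletion K) (CompletedAlgClosure (v'.adicCompletion K)) cP =
            (p : CompletedAlgClosure (v'.adicCompletion K)) ^ N *
              ∑' j : ℕ, PowerSeries.coeff j (Wm.map ((CBall (v'.adicCompletion K)).subtype.comp (EisensteinRoot.CoeffDisc.toCBall D))).formalLog *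
                ((zPt (AinfTop.geomToCO (Wm.map ψ₀) ((⇑φ ∘ Q) 0)) (hker 0) : CBall (v'.adicCompletion K)) : CompletedAlgClosure (v'.adicCompletion K)) ^ j →
          ((tatePairingPoint W (v'.adicCompletion K) p eT hμ hadd₁ hadd₂ hgal hcompat (oneCocycleClass _ η) P : ℤ_[p]) : ℚ_[p]) =
            -Algebra.trace ℚ_[p] (v'.adicCompletion K) (cP * (expStarCoord W hp' d η * c))) :
    letI := LocalField.adicCompletionPadicAlgebra v' p hv'
    ∃ c' : (v'.adicCompletion K),
      ∀ (η'' : contOneCocycles (restrictedTateRep W (v'.adicCompletion K) p).toTopRep) (P' : (W.baseChange (v'.adicCompletion K)).toAffine.Point),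
      ((tatePairingPoint W (v'.adicCompletion K) p eT hμ hadd₁ hadd₂ hgal hcompat (oneCocycleClass _ η'') P' : ℤ_[p]) : ℚ_[p]) =
        Algebra.trace ℚ_[p] (v'.adicCompletion K) (c' * expStarCoord W hp' d'' η'' * padicLogPointFiniteExt ω' (W.baseChange (v'.adicCompletion K)) p P') := by
  letI := LocalField.adicCompletionPadicAlgebra v' p hv'
  haveI : CharZero (CompletedAlgClosure (v'.adicCompletion K)) :=
    charZero_of_injective_algebraMap (algebraMap (v'.adicCompletion K) (CompletedAlgClosure (v'.adicCompletion K))).injective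
  have hpr : p.Prime := hp.out
  -- §1–§4: the cell's good model and its data (`…OrdinaryCellsModels`)
  obtain ⟨D, hD, a, b, Wm, ψ₀, Cv, hψ₀, hWm, hu, hCE, hΔ, hA, h1, hWE, hΔ₀, hA₀, htr, hnorm, hsq⟩ :=
    exists_goodModelData_of_ordinary_numerology W p hp57 hj he hem hen h₄ h₆ hm hn ht₄ ht₆ h5 h7 hαe v' hp'
  haveI hEll : (AinfTop.curveFO (v'.adicCompletion K) (Wm.map ψ₀)).IsElliptic := AinfTop.isElliptic_curveFO _ hΔ
  haveI hEllC : (curveOver (CompletedAlgClosure (v'.adicCompletion K)) (Wm.map ψ₀)).IsElliptic := AinfTop.isElliptic_curveOverC_O hΔ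
  set E₀ : WeierstrassCurve ℤ := ⟨0, 0, 0, if r₄ = 0 then a else 0, if r₆ = 0 then b else 0⟩ with hE₀
  have hE₀Δ0 : E₀.Δ ≠ 0 := fun h => hΔ₀ (h ▸ dvd_zero _)
  haveI : (E₀.map (Int.castRingHom ℚ_[p])).IsElliptic :=
    ⟨by rw [WeierstrassCurve.map_Δ, isUnit_iff_ne_zero, eq_intCast]; exact Int.cast_ne_zero.mpr hE₀Δ0⟩
  haveI : (E₀.map (Int.castRingHom (ZMod p))).IsElliptic :=
    ⟨by rw [WeierstrassCurve.map_Δ, isUnit_iff_ne_zero, eq_intCast, Ne, ZMod.intCast_zmod_eq_zero_iff_dvd]; exact_mod_cast hΔ₀⟩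
  haveI : (curveOver (CompletedAlgClosure (v'.adicCompletion K)) E₀).IsElliptic := AinfTop.isElliptic_curveOverC E₀ hE₀Δ0
  -- §6 the socket data for `W` over `F`: `|u| ≤ 1`, the `ℤ_p`-valued `log χ`, `heL/healt/henondeg` from `halt`, integrality of the model
  have huv : ω' (Cv.u : v'.adicCompletion K) ≤ 1 := by
    refine valuation_u_le_one_of_smul_eq_curveFO W v' ω' (Wm.map ψ₀) hΔ (C := Cv) ?_
    convert hCE using 3
    exact Subsingleton.elim _ _
  obtain ⟨ψ, hψ, hψlog⟩ := exists_continuousMap_coe_eq_logCyclotomic (v'.adicCompletion K) p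
  have heL := weilContPairingPadic_toLin_smul_left (F := (v'.adicCompletion K)) W eT hμ hadd₁ hadd₂ hgal hcompat halt
  have healt := weilContPairingPadic_toLin_self (F := (v'.adicCompletion K)) W eT hμ hadd₁ hadd₂ hgal hcompat halt
  have henondeg := weilContPairingPadic_toLin_nondegenerate (F := (v'.adicCompletion K)) W eT hμ hadd₁ hadd₂ hgal hcompat halt hnondeg
  haveI : (AinfTop.curveFO (v'.adicCompletion K) (Wm.map ψ₀)).IsIntegral ω'.integer := AinfTop.isIntegral_curveFO _ ω'
  have hde : ∀ η : contOneCocycles (restrictedTateRep W (v'.adicCompletion K) p).toTopRep,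
      (bdRPeriodRingData (F := (v'.adicCompletion K)) (p := p) hp').HasDualExp (logCyclotomic p)
        (restrictedRationalTateRep W (v'.adicCompletion K) p) fun σ => TateModule.toRational p (η.1 σ) := fun η => hdeK (pushRational p η)
  -- the capstone socket at this model datum (a depth `N`, then the formula for every transport `φ`); then E6 over the formal-point input
  obtain ⟨N, hN0, hformalT⟩ := hcap D hD a b Wm ψ₀ hψ₀ hWm hu hΔ hA h1 E₀ hE₀ hWE hΔ₀ hA₀ htr hnorm hsq ψ hψ hψlog heL healt henondeg hinjK hde d''
  -- E6 over the formal-point input (inlined twin of `…TransportedReciprocityOfVariableChangeOfFormalPoints`): transport data of `Cv`, log rescaling, E4/E5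
  haveI : (W.baseChange (v'.adicCompletion K)).IsElliptic := inferInstance
  obtain ⟨φ, Tφ, φF, hφ, hTφ, hφF, hφFC⟩ := exists_transportData_of_variableChange (W.baseChange (v'.adicCompletion K)) Cv p hCE
  have hlogφ : ∀ P, padicLogPointFiniteExt ω' (AinfTop.curveFO (v'.adicCompletion K) (Wm.map ψ₀)) p (φF P) =
      (Cv.u : v'.adicCompletion K) * padicLogPointFiniteExt ω' (W.baseChange (v'.adicCompletion K)) p P := fun P => by
    rw [hφFC P]
    exact padicLogPointFiniteExt_congrEquiv_pointMap_of_isNonarchimedeanLocalField (W.baseChange (v'.adicCompletion K)) Cv ω' hCE hp' huv P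
  exact TransportedReciprocityTransportAllPointsOfFormalPoints.exists_const_tatePairingPoint_eq_trace_mul_padicLog_transport_of_formalPoints_of_log_eq v' hp'
    D Wm ψ₀ hψ₀ hΔ h1 W φ eT hμ hadd₁ hadd₂ hgal hcompat ω' φF hφF hN0 d'' (hformalT φ hφ Tφ hTφ) ω' (Cv.u : v'.adicCompletion K) hlogφ


set_option maxHeartbeats 1600000 in
/-- ★★★ **`stub_localFormulaOrdinaryCells` of skeleton v11 REDUCED to the ordinary capstone socket.** For a globally minimal `W/ℚ` with `p ∈ {5, 7}`, additive reduction
at `p`, no `Iₙ*` fibre at `p`, `4 < ord_p Δ_min` and `(p = 5 ↔ ord_p Δ_min = 9)` — the (G)-ORDINARY cells `(5; III*)`, `(7; IV*)`, `(7; II*)` — a number field `K ∋ α` with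
`α^e = p`, `e` from the cell table (`9 ↦ 4`, `8 ↦ 3`, `10 ↦ 6`), a place `v′ ∋ p` with the packet keys, any compatible `ω′`, the ALTERNATING Weil tower of `W` and the
Prop-1.2.3 binders handed over — EXACTLY the binders of the stub — and GRANTED the ordinary capstone socket `hcap` for the cell's numerology `(r₄, r₆, t₄, t₆)`
(ordinary pattern): for every line datum `d″` SOME `c′` with `⟨[η″], P′⟩ = Tr_{K_{v′}/ℚ_p}(c′ · exp*_{d″}(η″) · log_{ω′} P′)`. So the registered stub follows from
`hcap` by `intro`s and this theorem. [cite: Kato1993LNM1553, Ch. II Thm. 1.4.1 (3)–(4), Lemma 1.4.3] [cite: SilvermanATAEC1994, IV Table 4.1]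
[cite: SilvermanAEC2009, VII.5.5, IV.4.4 and V.4.1] -/
theorem localFormulaOrdinaryCells_of_capstone (hp57 : p = 5 ∨ p = 7) (hadd : Addv W p)
    (hIstar : ∀ (v : HeightOneSpectrum ℤ) (n : ℕ), natGenerator v = p → W.kodairaSymbolAt v ≠ KodairaSymbol.Istar n)
    (h4 : 4 < padicValInt p W.minimalDiscriminantInt) (_h9 : p = 5 ↔ padicValInt p W.minimalDiscriminantInt = 9)
    {K : Type} [Field K] [NumberField K] (α : K) {e : ℕ}
    (htab : p = 5 ∧ padicValInt p W.minimalDiscriminantInt = 9 ∧ e = 4 ∨ p = 7 ∧ padicValInt p W.minimalDiscriminantInt = 8 ∧ e = 3 ∨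
      p = 7 ∧ padicValInt p W.minimalDiscriminantInt = 10 ∧ e = 6) (hαe : α ^ e = (p : K))
    (v' : HeightOneSpectrum (𝓞 K)) (hv' : ((p : ℕ) : 𝓞 K) ∈ v'.asIdeal)
    [CharZero (v'.adicCompletion K)] [Fact (¬ IsUnit ((p : ℕ) : integerC (v'.adicCompletion K)))]
    [IsAdicComplete (Ideal.span {((p : ℕ) : integerC (v'.adicCompletion K))}) (integerC (v'.adicCompletion K))]
    (hp' : valuation (v'.adicCompletion K) ((p : ℕ) : (v'.adicCompletion K)) < 1)
    (ω' : Valuation (v'.adicCompletion K) ℝ≥0) [ω'.Compatible] [(W.baseChange (v'.adicCompletion K)).IsIntegral ω'.integer]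
    (eT : (k : ℕ) → geomTorsion W ((p ^ k : ℕ) : ℤ) → geomTorsion W ((p ^ k : ℕ) : ℤ) → AlgebraicClosure ℚ) (hμ : ∀ k S T, eT k S T ^ (p ^ k) = 1)
    (hadd₁ : ∀ k S₁ S₂ T, eT k (S₁ + S₂) T = eT k S₁ T * eT k S₂ T) (hadd₂ : ∀ k S T₁ T₂, eT k S (T₁ + T₂) = eT k S T₁ * eT k S T₂)
    (hgal : ∀ k (σ : absoluteGaloisGroup ℚ) (S T : geomTorsion W ((p ^ k : ℕ) : ℤ)), σ • eT k S T = eT k (σ • S) (σ • T))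
    (hnondeg : ∀ k (T : geomTorsion W ((p ^ k : ℕ) : ℤ)), (∀ S, eT k S T = 1) → T = 0) (halt : ∀ k (S : geomTorsion W ((p ^ k : ℕ) : ℤ)), eT k S S = 1)
    (hcompat : ∀ k (S T : geomTorsion W ((p ^ (k + 1) : ℕ) : ℤ)),
      eT k (torsionMulHom W (p ^ (k + 1)) (p ^ k) p (pow_succ p k).symm S) (torsionMulHom W (p ^ (k + 1)) (p ^ k) p (pow_succ p k).symm T) = eT (k + 1) S T ^ p)
    (hinjK : letI := LocalField.adicCompletionPadicAlgebra v' p hv'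
      (bdRPeriodRingData (F := (v'.adicCompletion K)) (p := p) hp').CupLogInjective (logCyclotomic p) (restrictedRationalTateRep W (v'.adicCompletion K) p))
    (hdeK : letI := LocalField.adicCompletionPadicAlgebra v' p hv'
      ∀ z : contOneCocycles (restrictedRationalTateRep W (v'.adicCompletion K) p).toTopRep,
        (bdRPeriodRingData (F := (v'.adicCompletion K)) (p := p) hp').HasDualExp (logCyclotomic p) (restrictedRationalTateRep W (v'.adicCompletion K) p) fun σ => z.1 σ)
    (d'' : letI := LocalField.adicCompletionPadicAlgebra v' p hv'
      (bdRPeriodRingData (F := (v'.adicCompletion K)) (p := p) hp').FilZeroLine (restrictedRationalTateRep W (v'.adicCompletion K) p))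
    (hcap : letI := LocalField.padicAlgebra (v'.adicCompletion K) p hp'
      haveI : CharZero (CompletedAlgClosure (v'.adicCompletion K)) :=
        charZero_of_injective_algebraMap (algebraMap (v'.adicCompletion K) (CompletedAlgClosure (v'.adicCompletion K))).injective
      ∀ (r₄ r₆ t₄ t₆ : ℕ), ((p = 5 → r₄ = 0 ∧ t₄ = 0 ∧ 0 < t₆) ∧ (p = 7 → r₆ = 0 ∧ t₆ = 0 ∧ 0 < t₄)) →
      ∀ (D : EisensteinRoot (v'.adicCompletion K) p hp') (_hD : D.poly = X ^ e - C (p : ℤ_[p])) (a b : ℤ)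
        (Wm : WeierstrassCurve (EisensteinRoot.CoeffDisc D)) (ψ₀ : EisensteinRoot.CoeffDisc D →+* LTCoeff (v'.adicCompletion K))
        (_hψ₀ : ∀ c, algebraMap (LTCoeff (v'.adicCompletion K)) (v'.adicCompletion K) (ψ₀ c) = EisensteinRoot.CoeffDisc.toF D c)
        (_hWm : Wm = ⟨0, 0, 0, algebraMap ℤ (EisensteinRoot.CoeffDisc D) a * EisensteinRoot.CoeffDisc.of D (AdjoinRoot.root D.poly) ^ r₄,
          algebraMap ℤ (EisensteinRoot.CoeffDisc D) b * EisensteinRoot.CoeffDisc.of D (AdjoinRoot.root D.poly) ^ r₆⟩)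
        (_hu : IsUnit (64 * (a : ℤ_[p]) ^ 3 * (p : ℤ_[p]) ^ t₄ + 432 * (b : ℤ_[p]) ^ 2 * (p : ℤ_[p]) ^ t₆))
        (_hΔ : IsUnit (Wm.map ψ₀).Δ) (_hA : ((Wm.map ψ₀).map (AinfTop.redCoeff (v'.adicCompletion K))).hasseCoeff p ≠ 0)
        (_h1 : IsUnit (algebraMap (LTCoeff (v'.adicCompletion K)) (CBall (v'.adicCompletion K)) (PowerSeries.coeff p ((Wm.map ψ₀).formalMul p))))
        [(AinfTop.curveFO (v'.adicCompletion K) (Wm.map ψ₀)).IsElliptic]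
        [(curveOver (CompletedAlgClosure (v'.adicCompletion K)) (Wm.map ψ₀)).IsElliptic]
        (E₀ : WeierstrassCurve ℤ) (_hE₀ : E₀ = ⟨0, 0, 0, if r₄ = 0 then a else 0, if r₆ = 0 then b else 0⟩)
        (_hWE : Wm.map (Ideal.Quotient.mk (Ideal.span {EisensteinRoot.CoeffDisc.of D (AdjoinRoot.root D.poly)})) =
          (E₀.map (algebraMap ℤ (EisensteinRoot.CoeffDisc D))).map (Ideal.Quotient.mk (Ideal.span {EisensteinRoot.CoeffDisc.of D (AdjoinRoot.root D.poly)})))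
        (_hΔ₀ : ¬ (p : ℤ) ∣ E₀.Δ) (_hA₀ : (E₀.map (Int.castRingHom (ZMod p))).hasseCoeff p ≠ 0)
        (_htr : ¬ (p : ℤ) ∣ HasseManin.tr (E₀.map (Int.castRingHom (ZMod p))))
        (_hnorm : ‖((HasseManin.tr (E₀.map (Int.castRingHom (ZMod p))) : ℤ) : ℤ_[p])‖ = 1)
        (_hsq : HasseManin.tr (E₀.map (Int.castRingHom (ZMod p))) ^ 2 < 4 * p)
        [(E₀.map (Int.castRingHom ℚ_[p])).IsElliptic] [(E₀.map (Int.castRingHom (ZMod p))).IsElliptic]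
        [(curveOver (CompletedAlgClosure (v'.adicCompletion K)) E₀).IsElliptic]
        -- socket data of `W` over `F`
        (ψ : C(absoluteGaloisGroup (v'.adicCompletion K), ℤ_[p])) (_hψ : ∀ σ τ, ψ (σ * τ) = ψ σ + ψ τ)
        (_hψlog : ∀ τ, (ψ τ : ℚ_[p]) = logCyclotomic (F := (v'.adicCompletion K)) p τ)
        (_heL : ∀ (c : ℤ_[p]) (S U : W.tateModule p),
          (weilContPairingPadic W (v'.adicCompletion K) p eT hμ hadd₁ hadd₂ hgal hcompat).toLin (c • S) U =
          twistHom (v'.adicCompletion K) p ((weilContPairingPadic W (v'.adicCompletion K) p eT hμ hadd₁ hadd₂ hgal hcompat).toLin S U) c)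
        (_healt : ∀ S : W.tateModule p, (weilContPairingPadic W (v'.adicCompletion K) p eT hμ hadd₁ hadd₂ hgal hcompat).toLin S S = 0)
        (_henondeg : ∀ S : W.tateModule p,
          (∀ U, (weilContPairingPadic W (v'.adicCompletion K) p eT hμ hadd₁ hadd₂ hgal hcompat).toLin S U = 0) → S = 0)
        (_hinj : (bdRPeriodRingData (F := (v'.adicCompletion K)) (p := p) hp').CupLogInjective (logCyclotomic p)
          (restrictedRationalTateRep W (v'.adicCompletion K) p))
        (_hde : ∀ η : contOneCocycles (restrictedTateRep W (v'.adicCompletion K) p).toTopRep,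
          (bdRPeriodRingData (F := (v'.adicCompletion K)) (p := p) hp').HasDualExp (logCyclotomic p)
            (restrictedRationalTateRep W (v'.adicCompletion K) p) fun σ => TateModule.toRational p (η.1 σ))
        (d : (bdRPeriodRingData (F := (v'.adicCompletion K)) (p := p) hp').FilZeroLine (restrictedRationalTateRep W (v'.adicCompletion K) p))
        -- a depth `N ≥ 1`, then: the transport isomorphism onto the model and its Tate-module map
        , ∃ N : ℕ, N ≠ 0 ∧
      ∀ (φ : geomPoints (W.baseChange (v'.adicCompletion K)) ≃+ (AinfTop.curveFO (v'.adicCompletion K) (Wm.map ψ₀)).geomPoints)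
        (_hφ : ∀ (σ : absoluteGaloisGroup (v'.adicCompletion K)) (P : geomPoints (W.baseChange (v'.adicCompletion K))), φ (σ • P) = σ • φ P)
        (Tφ : (W.baseChange (v'.adicCompletion K)).tateModule p ≃ₗ[ℤ_[p]] (AinfTop.curveFO (v'.adicCompletion K) (Wm.map ψ₀)).tateModule p)
        (_hTφ : ∀ (a : (W.baseChange (v'.adicCompletion K)).tateModule p) (n : ℕ), TateModule.proj p n (Tφ a) = φ (TateModule.proj p n a)),
      ∃ c : v'.adicCompletion K,
      ∀ (η : contOneCocycles (restrictedTateRep W (v'.adicCompletion K) p).toTopRep)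
        (P : (W.baseChange (v'.adicCompletion K)).toAffine.Point)
        (Q : ℕ → geomPoints (W.baseChange (v'.adicCompletion K)))
        (_hQ : ∀ n, p • Q (n + 1) = Q n)
        (_hQ0 : Q 0 = toGeomPoints (W.baseChange (v'.adicCompletion K)) P)
        (hker : ∀ n, AinfTop.geomToCO (Wm.map ψ₀) ((⇑φ ∘ Q) n) ∈ kernel (NormedField.valuation (K := CompletedAlgClosure (v'.adicCompletion K)))
          (curveOver (CompletedAlgClosure (v'.adicCompletion K)) (Wm.map ψ₀))),
        ‖((zPt (AinfTop.geomToCO (Wm.map ψ₀) ((⇑φ ∘ Q) 0)) (hker 0) : CBall (v'.adicCompletion K)) : CompletedAlgClosure (v'.adicCompletion K))‖ ^ N ≤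
            ‖(p : CompletedAlgClosure (v'.adicCompletion K))‖ →
        ∀ cP : v'.adicCompletion K,
          algebraMap (v'.adicCompletion K) (CompletedAlgClosure (v'.adicCompletion K)) cP =
            (p : CompletedAlgClosure (v'.adicCompletion K)) ^ N *
              ∑' j : ℕ, PowerSeries.coeff j (Wm.map ((CBall (v'.adicCompletion K)).subtype.comp (EisensteinRoot.CoeffDisc.toCBall D))).formalLog *
                ((zPt (AinfTop.geomToCO (Wm.map ψ₀) ((⇑φ ∘ Q) 0)) (hker 0) : CBall (v'.adicCompletion K)) : CompletedAlgClosure (v'.adicCompletion K)) ^ j →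
          ((tatePairingPoint W (v'.adicCompletion K) p eT hμ hadd₁ hadd₂ hgal hcompat (oneCocycleClass _ η) P : ℤ_[p]) : ℚ_[p]) =
            -Algebra.trace ℚ_[p] (v'.adicCompletion K) (cP * (expStarCoord W hp' d η * c))) :
    letI := LocalField.adicCompletionPadicAlgebra v' p hv'
    ∃ c' : (v'.adicCompletion K),
      ∀ (η'' : contOneCocycles (restrictedTateRep W (v'.adicCompletion K) p).toTopRep) (P' : (W.baseChange (v'.adicCompletion K)).toAffine.Point),
      ((tatePairingPoint W (v'.adicCompletion K) p eT hμ hadd₁ hadd₂ hgal hcompat (oneCocycleClass _ η'') P' : ℤ_[p]) : ℚ_[p]) =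
        Algebra.trace ℚ_[p] (v'.adicCompletion K) (c' * expStarCoord W hp' d'' η'' * padicLogPointFiniteExt ω' (W.baseChange (v'.adicCompletion K)) p P') := by
  have hp5 : 5 ≤ p := by rcases hp57 with rfl | rfl <;> norm_num
  have hgen : natGenerator (placeOf p) = p := congrArg Subtype.val ((primesEquiv (R := ℤ)).apply_symm_apply ⟨p, hp.out⟩)
  obtain ⟨hj, -⟩ := padicValRat_j_nonneg_and_mem_of_starred W p hp5 hadd (fun n => hIstar (placeOf p) n hgen) h4
  rcases htab with ⟨rfl, h9, rfl⟩ | ⟨rfl, h8, rfl⟩ | ⟨rfl, h10, rfl⟩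
  · exact localFormula_of_ordinary_numerology_of_capstone W 5 (Or.inl rfl) hj (e := 4) (k := 3) (m := 3) (n := 5) (r₄ := 0) (r₆ := 2) (t₄ := 0) (t₆ := 1)
      (by norm_num) (by norm_num) (by norm_num) (by norm_num) (by norm_num) (by rw [h9]) (by rw [h9]) (by norm_num) (by norm_num)
      (fun _ => ⟨rfl, rfl, by norm_num⟩) (fun h => by norm_num at h) hαe v' hv' hp' ω' eT hμ hadd₁ hadd₂ hgal hnondeg halt hcompat hinjK hdeK d''
      (hcap 0 2 0 1 ⟨fun _ => ⟨rfl, rfl, by norm_num⟩, fun h => by norm_num at h⟩)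
  · exact localFormula_of_ordinary_numerology_of_capstone W 7 (Or.inr rfl) hj (e := 3) (k := 2) (m := 3) (n := 4) (r₄ := 1) (r₆ := 0) (t₄ := 1) (t₆ := 0)
      (by norm_num) (by norm_num) (by norm_num) (by norm_num) (by norm_num) (by rw [h8]) (by rw [h8]) (by norm_num) (by norm_num)
      (fun h => by norm_num at h) (fun _ => ⟨rfl, rfl, by norm_num⟩) hαe v' hv' hp' ω' eT hμ hadd₁ hadd₂ hgal hnondeg halt hcompat hinjK hdeK d''
      (hcap 1 0 1 0 ⟨fun h => by norm_num at h, fun _ => ⟨rfl, rfl, by norm_num⟩⟩)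
  · exact localFormula_of_ordinary_numerology_of_capstone W 7 (Or.inr rfl) hj (e := 6) (k := 5) (m := 4) (n := 5) (r₄ := 4) (r₆ := 0) (t₄ := 2) (t₆ := 0)
      (by norm_num) (by norm_num) (by norm_num) (by norm_num) (by norm_num) (by rw [h10]) (by rw [h10]) (by norm_num) (by norm_num)
      (fun h => by norm_num at h) (fun _ => ⟨rfl, rfl, by norm_num⟩) hαe v' hv' hp' ω' eT hμ hadd₁ hadd₂ hgal hnondeg halt hcompat hinjK hdeK d''
      (hcap 4 0 2 0 ⟨fun h => by norm_num at h, fun _ => ⟨rfl, rfl, by norm_num⟩⟩)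

end Summit.BirchSwinnertonDyer.BirchSwinnertonDyer.Theorems.StarredOptimalManinUnitFiveSevenLocalFormulaOrdinaryCellsOfCapstone

end
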